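import Summits.ABC.ABC.Theses.DefiniteXi
import Summits.ABC.ABC.Theorems.DefiniteXiEisensteinQuarantineLatticeDepthDvdIff
import Summits.ABC.ABC.Theorems.DefiniteXiEisensteinQuarantineThreeAdicCalibration
import Summits.ABC.ABC.Theorems.DefiniteXiEisensteinQuarantineGcdWeightMulDvdTwelve
import Literature.NumberTheory.EllipticCurves.SerreFreyValuationProductProofs
import HarnessLib

/-!
# The forced-pair occurrence (stub `stub_forcedPairOccurrence` of line `forced-pair-dlog`, crux
`EisensteinQuarantine`, stmt-ABC-15023) — DICTIONARY FORM and reduction to a pure valuation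
statement about `ξ`

The registered stub `stub_forcedPairOccurrence` (THE research mechanism of the idea card
`forced-pair-dlog`; not a published theorem) says: there is `c` such that for all primes `q ≠ 2`,
`ℓ` with `32 q ∣ ℓ − 1`, for the Frey curve `E = E_(−ℓ, ℓ−1)` of the triple `1 + (ℓ − 1) = ℓ`
(conductor `N = rad(ℓ(ℓ−1))`), every Brandt setup `S` of type `(N/ℓ, ℓ)` and every generator `φ`
of the `a(E)`-eigen-line of the Brandt matrices, some `ψ` in the `w`-orthogonal complement of `φ`
(Gross weights `w_i = |O_iˣ|/2`) has `φ ≡ ψ (mod 2^{v₂(q−1) − c})`.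

Nothing in the tree computes a Brandt matrix, a class number or `ξ`, and the lower bound needs
Jacquet–Langlands + the 2-adic Eisenstein theory (Mazur 1977, Ribet 1990 / Diamond–Taylor 1994,
Calegari–Emerton 2005), none of which is in the tree; so the stub is not proved here.  This file
records, sorry-free, what the stub IS:

* `forcedPairOccurrence_iff_dvd` — by the landed dictionary `stub_latticeDepth_dvd_iff`
  (p96490) the inner statement is `m ∣ ξ_ℤ / d`, `ξ_ℤ = Σ_i w_i φ_i²`, `d = gcd_i (w_i φ_i)`;
* `stub_forcedPairOccurrence_iff_dvd` / `stub_forcedPairOccurrence_of_dvd` — hence the stub is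
  EQUIVALENT to the divisibility `2^{v₂(q−1)−c} ∣ ξ_ℤ / d` on the forced family (same `c`);
* `stub_forcedPairOccurrence_iff_dvd_xi` / `stub_forcedPairOccurrence_of_dvd_xi` — and, since on
  a line `ξ_ℤ = S.xi` (`Brandt.xi_eq_sum`), `d ∣ ξ_ℤ` and `d ∣ 12` (`stub_gcdWeightMulDvdTwelve`),
  EQUIVALENT (with `c ↦ c`, resp. `c ↦ c + 2`) to the pure valuation statement
  `2^{v₂(q−1) − c} ∣ S.xi (a(E))`, i.e. `v₂ ξ_S(E_(−ℓ,ℓ−1); N/ℓ, ℓ) ≥ v₂(q − 1) − c`: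
  a LOWER bound on the 2-adic valuation of the definite congruence number of `f_E` on the
  two-parameter forced family — the exact arithmetic content a prover / disprover must settle.
* `forcedPair_sideConditions_nonvacuous` — the side conditions are satisfiable with a
  non-trivial modulus: `(q, ℓ) = (17, 5441)` (`5440 = 32·17·10`, `v₂(16) = 4`).
-/

-- `Summit.<Summit>.<Problem>`: for the single-conjunct summit `ABC` the duplicate `ABC.ABC` is mandated.
set_option linter.dupNamespace false

noncomputable section

namespace Summit.ABC.ABC.Theorems

open scoped BigOperators
open Literature.NumberTheory.Automorphic Literature.NumberTheory.EllipticCurves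

/-! ## The dictionary form of one occurrence -/

/-- **Occurrence modulo `m` ⟺ `m ∣ ξ_ℤ / d`.**  In a Brandt setup `S` with Gross weights
`w = Brandt.weight S.O`, for any `φ` and `m : ℤ`: a `w`-orthogonal `ψ` with `φ ≡ ψ (mod m)` exists
iff `m ∣ (Σ_i w_i φ_i²) / gcd_i (w_i φ_i)` — the landed dictionary `stub_latticeDepth_dvd_iff`
(p96490) read from right to left. -/
theorem forcedPairOccurrence_iff_dvd {Nplus Nminus : ℕ} (S : Brandt.XiSetup Nplus Nminus)
    [Fintype (Brandt.ClassSet S.O)] (φ : Brandt.ClassSet S.O → ℤ) (m : ℤ) :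
    (∃ ψ : Brandt.ClassSet S.O → ℤ,
        ∑ i, (Brandt.weight S.O i : ℤ) * ψ i * φ i = 0 ∧ ∀ i, m ∣ φ i - ψ i) ↔
      m ∣ (∑ i, (Brandt.weight S.O i : ℤ) * φ i ^ 2) /
        Finset.univ.gcd (fun i => (Brandt.weight S.O i : ℤ) * φ i) :=
  (stub_latticeDepth_dvd_iff (Brandt.weight S.O) φ m).symm

/-! ## The stub ⟺ the divisibility `2^{v₂(q−1)−c} ∣ ξ_ℤ / d` on the forced family -/

/-- **The registered stub is equivalent to its dictionary form** (same constant `c`):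
`stub_forcedPairOccurrence ⟺ ∃ c, ∀ (forced data), 2^{v₂(q−1)−c} ∣ ξ_ℤ / d`. -/
theorem stub_forcedPairOccurrence_iff_dvd :
    (∃ c : ℕ, ∀ q ℓ : ℕ, q.Prime → ℓ.Prime → q ≠ 2 → 32 * q ∣ ℓ - 1 →
      ∀ N : ℕ, (freyCurve (-(ℓ : ℤ)) ((ℓ - 1 : ℕ) : ℤ)).conductorNorm ℤ = N →
      ∀ (S : Brandt.XiSetup (N / ℓ) ℓ) [Fintype (Brandt.ClassSet S.O)],
        ∀ φ : Brandt.ClassSet S.O → ℤ, φ ≠ 0 →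
          Brandt.eigenLattice (N / ℓ * ℓ) (Brandt.matrix S.O)
              (fun n => (freyCurve (-(ℓ : ℤ)) ((ℓ - 1 : ℕ) : ℤ)).LFunction n) = ℤ ∙ φ →
          ∃ ψ : Brandt.ClassSet S.O → ℤ,
            ∑ i, (Brandt.weight S.O i : ℤ) * ψ i * φ i = 0 ∧
              ∀ i, ((2 ^ ((q - 1).factorization 2 - c) : ℕ) : ℤ) ∣ φ i - ψ i) ↔
    (∃ c : ℕ, ∀ q ℓ : ℕ, q.Prime → ℓ.Prime → q ≠ 2 → 32 * q ∣ ℓ - 1 →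
      ∀ N : ℕ, (freyCurve (-(ℓ : ℤ)) ((ℓ - 1 : ℕ) : ℤ)).conductorNorm ℤ = N →
      ∀ (S : Brandt.XiSetup (N / ℓ) ℓ) [Fintype (Brandt.ClassSet S.O)],
        ∀ φ : Brandt.ClassSet S.O → ℤ, φ ≠ 0 →
          Brandt.eigenLattice (N / ℓ * ℓ) (Brandt.matrix S.O)
              (fun n => (freyCurve (-(ℓ : ℤ)) ((ℓ - 1 : ℕ) : ℤ)).LFunction n) = ℤ ∙ φ →
          ((2 ^ ((q - 1).factorization 2 - c) : ℕ) : ℤ) ∣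
            (∑ i, (Brandt.weight S.O i : ℤ) * φ i ^ 2) /
              Finset.univ.gcd (fun i => (Brandt.weight S.O i : ℤ) * φ i)) := by
  refine exists_congr fun c => ?_
  refine forall₂_congr fun q ℓ => forall₄_congr fun _ _ _ _ => forall₂_congr fun N _ => ?_
  refine forall₂_congr fun S _ => forall₃_congr fun φ _ _ => ?_
  exact forcedPairOccurrence_iff_dvd S φ _

/-- **Reduction of the stub to the divisibility form**: if `∃ c, ∀ (forced data),
2^{v₂(q−1)−c} ∣ ξ_ℤ / d`, then `stub_forcedPairOccurrence` (verbatim). -/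
theorem stub_forcedPairOccurrence_of_dvd
    (h : ∃ c : ℕ, ∀ q ℓ : ℕ, q.Prime → ℓ.Prime → q ≠ 2 → 32 * q ∣ ℓ - 1 →
      ∀ N : ℕ, (freyCurve (-(ℓ : ℤ)) ((ℓ - 1 : ℕ) : ℤ)).conductorNorm ℤ = N →
      ∀ (S : Brandt.XiSetup (N / ℓ) ℓ) [Fintype (Brandt.ClassSet S.O)],
        ∀ φ : Brandt.ClassSet S.O → ℤ, φ ≠ 0 →
          Brandt.eigenLattice (N / ℓ * ℓ) (Brandt.matrix S.O)
              (fun n => (freyCurve (-(ℓ : ℤ)) ((ℓ - 1 : ℕ) : ℤ)).LFunction n) = ℤ ∙ φ →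
          ((2 ^ ((q - 1).factorization 2 - c) : ℕ) : ℤ) ∣
            (∑ i, (Brandt.weight S.O i : ℤ) * φ i ^ 2) /
              Finset.univ.gcd (fun i => (Brandt.weight S.O i : ℤ) * φ i)) :
    ∃ c : ℕ, ∀ q ℓ : ℕ, q.Prime → ℓ.Prime → q ≠ 2 → 32 * q ∣ ℓ - 1 →
      ∀ N : ℕ, (freyCurve (-(ℓ : ℤ)) ((ℓ - 1 : ℕ) : ℤ)).conductorNorm ℤ = N →
      ∀ (S : Brandt.XiSetup (N / ℓ) ℓ) [Fintype (Brandt.ClassSet S.O)],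
        ∀ φ : Brandt.ClassSet S.O → ℤ, φ ≠ 0 →
          Brandt.eigenLattice (N / ℓ * ℓ) (Brandt.matrix S.O)
              (fun n => (freyCurve (-(ℓ : ℤ)) ((ℓ - 1 : ℕ) : ℤ)).LFunction n) = ℤ ∙ φ →
          ∃ ψ : Brandt.ClassSet S.O → ℤ,
            ∑ i, (Brandt.weight S.O i : ℤ) * ψ i * φ i = 0 ∧
              ∀ i, ((2 ^ ((q - 1).factorization 2 - c) : ℕ) : ℤ) ∣ φ i - ψ i :=
  stub_forcedPairOccurrence_iff_dvd.mpr h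

/-! ## The stub ⟺ the pure valuation statement `2^{v₂(q−1)−c} ∣ ξ_S` -/

/-- **Arithmetic of the defect `d ∣ 12`.**  If `d ∣ 12`, `d ∣ x` and `2^k ∣ x` (in `ℤ`), then
`2^{k−2} ∣ x / d`: the quotient loses at most the two factors `2` of `12`. -/
theorem two_pow_sub_two_dvd_div {x d : ℤ} {k : ℕ} (hd12 : d ∣ 12) (hdx : d ∣ x)
    (h : (2 : ℤ) ^ k ∣ x) : (2 : ℤ) ^ (k - 2) ∣ x / d := by
  obtain ⟨t, rfl⟩ := hdx
  by_cases hd0 : d = 0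
  · rw [hd0, zero_mul, Int.ediv_zero]; exact dvd_zero _
  rw [Int.mul_ediv_cancel_left _ hd0]
  obtain ⟨e, he⟩ := hd12
  -- `2^k ∣ 12 t = e (d t)`
  have h12 : (2 : ℤ) ^ k ∣ 12 * t := by
    rw [he, mul_comm d e, mul_assoc]
    exact h.mul_left e
  rcases lt_or_ge k 2 with hk | hk
  · rw [Nat.sub_eq_zero_of_le hk.le, pow_zero]; exact one_dvd _
  · -- `2^k = 4 · 2^{k-2}` and `12 t = 4 · (3 t)`
    have hpow : (2 : ℤ) ^ k = 4 * 2 ^ (k - 2) := by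
      rw [← Nat.sub_add_cancel hk, pow_add, Nat.add_sub_cancel]; ring
    rw [hpow, show (12 : ℤ) * t = 4 * (3 * t) by ring] at h12
    have h3 : (2 : ℤ) ^ (k - 2) ∣ 3 * t := (mul_dvd_mul_iff_left (by norm_num)).mp h12
    have hcop : IsCoprime ((2 : ℤ) ^ (k - 2)) 3 :=
      (Int.isCoprime_iff_gcd_eq_one.mpr (by norm_num)).pow_left
    exact hcop.dvd_of_dvd_mul_left h3

/-- **On an eigen-line `ξ_ℤ = S.xi`** (as integers): `Σ_i w_i φ_i² = S.xi λ` when the eigen-lattice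
of `λ` is `ℤ φ`, `φ ≠ 0` (`Brandt.xi_eq_sum`). -/
theorem sum_weight_mul_sq_eq_xi {Nplus Nminus : ℕ} (S : Brandt.XiSetup Nplus Nminus)
    (lam : ℕ → ℤ) [Fintype (Brandt.ClassSet S.O)] {φ : Brandt.ClassSet S.O → ℤ} (hφ : φ ≠ 0)
    (hL : Brandt.eigenLattice (Nplus * Nminus) (Brandt.matrix S.O) lam = ℤ ∙ φ) :
    ∑ i, (Brandt.weight S.O i : ℤ) * φ i ^ 2 = (S.xi lam : ℤ) := by
  rw [Brandt.XiSetup.xi, Brandt.xiOfOrder_eq, Brandt.xi_eq_sum _ hφ hL]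
  push_cast
  exact Finset.sum_congr rfl fun i _ => by rw [sq_abs]

/-- **`2^k ∣ S.xi ⟹ 2^{k−2} ∣ ξ_ℤ / d` on an eigen-line**: `d = gcd_i (w_i φ_i)` divides `ξ_ℤ` and
`12` (`stub_gcdWeightMulDvdTwelve`), and `ξ_ℤ = S.xi` (`sum_weight_mul_sq_eq_xi`). -/
theorem two_pow_sub_two_dvd_div_of_dvd_xi {Nplus Nminus : ℕ} (S : Brandt.XiSetup Nplus Nminus)
    (lam : ℕ → ℤ) [Fintype (Brandt.ClassSet S.O)] {φ : Brandt.ClassSet S.O → ℤ} (hφ : φ ≠ 0)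
    (hL : Brandt.eigenLattice (Nplus * Nminus) (Brandt.matrix S.O) lam = ℤ ∙ φ) {k : ℕ}
    (h : 2 ^ k ∣ S.xi lam) :
    ((2 ^ (k - 2) : ℕ) : ℤ) ∣ (∑ i, (Brandt.weight S.O i : ℤ) * φ i ^ 2) /
      Finset.univ.gcd (fun i => (Brandt.weight S.O i : ℤ) * φ i) := by
  have hdξ : Finset.univ.gcd (fun i => (Brandt.weight S.O i : ℤ) * φ i) ∣
      ∑ i, (Brandt.weight S.O i : ℤ) * φ i ^ 2 := by
    refine Finset.dvd_sum fun i _ => ?_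
    rw [show (Brandt.weight S.O i : ℤ) * φ i ^ 2 = (Brandt.weight S.O i : ℤ) * φ i * φ i by ring]
    exact (Finset.gcd_dvd (Finset.mem_univ i)).mul_right _
  have hd12 : Finset.univ.gcd (fun i => (Brandt.weight S.O i : ℤ) * φ i) ∣ 12 :=
    stub_gcdWeightMulDvdTwelve S lam φ hφ hL
  have hZ : (2 : ℤ) ^ k ∣ ∑ i, (Brandt.weight S.O i : ℤ) * φ i ^ 2 := by
    rw [sum_weight_mul_sq_eq_xi S lam hφ hL]
    exact_mod_cast h
  push_cast
  exact two_pow_sub_two_dvd_div hd12 hdξ hZ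

/-- **The registered stub is equivalent to a pure valuation statement about `ξ`**:
`stub_forcedPairOccurrence ⟺ ∃ c, ∀ (forced data: primes q ≠ 2, ℓ, 32q ∣ ℓ−1, N the conductor of
E_(−ℓ,ℓ−1), S a setup of type (N/ℓ, ℓ), φ ≠ 0 generating the a(E)-eigen-line),
2^{v₂(q−1) − c} ∣ S.xi (a(E))`, i.e. `v₂ ξ_S ≥ v₂(q−1) − c`.  (→) with the same `c`: an occurrence
modulo `2^k` forces `2^k ∣ S.xi` (`dvd_xi_of_occurrence`, p97646).  (←) with `c ↦ c + 2`:
`2^k ∣ S.xi = ξ_ℤ = d · (ξ_ℤ/d)` and `d ∣ 12` give `2^{k−2} ∣ ξ_ℤ / d`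
(`two_pow_sub_two_dvd_div_of_dvd_xi`), then the dictionary. -/
theorem stub_forcedPairOccurrence_iff_dvd_xi :
    (∃ c : ℕ, ∀ q ℓ : ℕ, q.Prime → ℓ.Prime → q ≠ 2 → 32 * q ∣ ℓ - 1 →
      ∀ N : ℕ, (freyCurve (-(ℓ : ℤ)) ((ℓ - 1 : ℕ) : ℤ)).conductorNorm ℤ = N →
      ∀ (S : Brandt.XiSetup (N / ℓ) ℓ) [Fintype (Brandt.ClassSet S.O)],
        ∀ φ : Brandt.ClassSet S.O → ℤ, φ ≠ 0 →
          Brandt.eigenLattice (N / ℓ * ℓ) (Brandt.matrix S.O)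
              (fun n => (freyCurve (-(ℓ : ℤ)) ((ℓ - 1 : ℕ) : ℤ)).LFunction n) = ℤ ∙ φ →
          ∃ ψ : Brandt.ClassSet S.O → ℤ,
            ∑ i, (Brandt.weight S.O i : ℤ) * ψ i * φ i = 0 ∧
              ∀ i, ((2 ^ ((q - 1).factorization 2 - c) : ℕ) : ℤ) ∣ φ i - ψ i) ↔
    (∃ c : ℕ, ∀ q ℓ : ℕ, q.Prime → ℓ.Prime → q ≠ 2 → 32 * q ∣ ℓ - 1 →
      ∀ N : ℕ, (freyCurve (-(ℓ : ℤ)) ((ℓ - 1 : ℕ) : ℤ)).conductorNorm ℤ = N →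
      ∀ (S : Brandt.XiSetup (N / ℓ) ℓ) [Fintype (Brandt.ClassSet S.O)],
        ∀ φ : Brandt.ClassSet S.O → ℤ, φ ≠ 0 →
          Brandt.eigenLattice (N / ℓ * ℓ) (Brandt.matrix S.O)
              (fun n => (freyCurve (-(ℓ : ℤ)) ((ℓ - 1 : ℕ) : ℤ)).LFunction n) = ℤ ∙ φ →
          2 ^ ((q - 1).factorization 2 - c) ∣
            S.xi (fun n => (freyCurve (-(ℓ : ℤ)) ((ℓ - 1 : ℕ) : ℤ)).LFunction n)) := by
  constructor
  · rintro ⟨c, hc⟩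
    refine ⟨c, fun q ℓ hq hℓ hq2 h32 N hN S _ φ hφ hL => ?_⟩
    obtain ⟨ψ, hψ, hcong⟩ := hc q ℓ hq hℓ hq2 h32 N hN S φ hφ hL
    exact (dvd_xi_of_occurrence S _ hφ hL _ hψ hcong).1
  · rintro ⟨c, hc⟩
    refine ⟨c + 2, fun q ℓ hq hℓ hq2 h32 N hN S _ φ hφ hL => ?_⟩
    refine (forcedPairOccurrence_iff_dvd S φ _).mpr ?_
    rw [← Nat.sub_sub]
    exact two_pow_sub_two_dvd_div_of_dvd_xi S _ hφ hL (hc q ℓ hq hℓ hq2 h32 N hN S φ hφ hL)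

/-- **Reduction of the stub to the pure valuation statement**: if `∃ c, ∀ (forced data),
2^{v₂(q−1)−c} ∣ S.xi (a(E))`, then `stub_forcedPairOccurrence` (verbatim, with `c + 2`). -/
theorem forcedPairOccurrence_of_dvd_xi
    (h : ∃ c : ℕ, ∀ q ℓ : ℕ, q.Prime → ℓ.Prime → q ≠ 2 → 32 * q ∣ ℓ - 1 →
      ∀ N : ℕ, (freyCurve (-(ℓ : ℤ)) ((ℓ - 1 : ℕ) : ℤ)).conductorNorm ℤ = N →
      ∀ (S : Brandt.XiSetup (N / ℓ) ℓ) [Fintype (Brandt.ClassSet S.O)],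
        ∀ φ : Brandt.ClassSet S.O → ℤ, φ ≠ 0 →
          Brandt.eigenLattice (N / ℓ * ℓ) (Brandt.matrix S.O)
              (fun n => (freyCurve (-(ℓ : ℤ)) ((ℓ - 1 : ℕ) : ℤ)).LFunction n) = ℤ ∙ φ →
          2 ^ ((q - 1).factorization 2 - c) ∣
            S.xi (fun n => (freyCurve (-(ℓ : ℤ)) ((ℓ - 1 : ℕ) : ℤ)).LFunction n)) :
    ∃ c : ℕ, ∀ q ℓ : ℕ, q.Prime → ℓ.Prime → q ≠ 2 → 32 * q ∣ ℓ - 1 →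
      ∀ N : ℕ, (freyCurve (-(ℓ : ℤ)) ((ℓ - 1 : ℕ) : ℤ)).conductorNorm ℤ = N →
      ∀ (S : Brandt.XiSetup (N / ℓ) ℓ) [Fintype (Brandt.ClassSet S.O)],
        ∀ φ : Brandt.ClassSet S.O → ℤ, φ ≠ 0 →
          Brandt.eigenLattice (N / ℓ * ℓ) (Brandt.matrix S.O)
              (fun n => (freyCurve (-(ℓ : ℤ)) ((ℓ - 1 : ℕ) : ℤ)).LFunction n) = ℤ ∙ φ →
          ∃ ψ : Brandt.ClassSet S.O → ℤ,
            ∑ i, (Brandt.weight S.O i : ℤ) * ψ i * φ i = 0 ∧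
              ∀ i, ((2 ^ ((q - 1).factorization 2 - c) : ℕ) : ℤ) ∣ φ i - ψ i :=
  stub_forcedPairOccurrence_iff_dvd_xi.mpr h

/-- **Uncurried form, registered as a sub-goal of stmt-ABC-15023** (`--supports` files must prove a
registered stub by name and verbatim uncurried signature; `forcedPairOccurrence_of_dvd_xi` is the
working corollary): the valuation form `∃ c, ∀ (forced data), 2^{v₂(q−1)−c} ∣ S.xi (a(E))` implies
`stub_forcedPairOccurrence` verbatim. -/
theorem stub_forcedPairOccurrence_of_dvd_xi :
    (∃ c : ℕ, ∀ q ℓ : ℕ, q.Prime → ℓ.Prime → q ≠ 2 → 32 * q ∣ ℓ - 1 →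
      ∀ N : ℕ, (freyCurve (-(ℓ : ℤ)) ((ℓ - 1 : ℕ) : ℤ)).conductorNorm ℤ = N →
      ∀ (S : Brandt.XiSetup (N / ℓ) ℓ) [Fintype (Brandt.ClassSet S.O)],
        ∀ φ : Brandt.ClassSet S.O → ℤ, φ ≠ 0 →
          Brandt.eigenLattice (N / ℓ * ℓ) (Brandt.matrix S.O)
              (fun n => (freyCurve (-(ℓ : ℤ)) ((ℓ - 1 : ℕ) : ℤ)).LFunction n) = ℤ ∙ φ →
          2 ^ ((q - 1).factorization 2 - c) ∣
            S.xi (fun n => (freyCurve (-(ℓ : ℤ)) ((ℓ - 1 : ℕ) : ℤ)).LFunction n)) →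
    ∃ c : ℕ, ∀ q ℓ : ℕ, q.Prime → ℓ.Prime → q ≠ 2 → 32 * q ∣ ℓ - 1 →
      ∀ N : ℕ, (freyCurve (-(ℓ : ℤ)) ((ℓ - 1 : ℕ) : ℤ)).conductorNorm ℤ = N →
      ∀ (S : Brandt.XiSetup (N / ℓ) ℓ) [Fintype (Brandt.ClassSet S.O)],
        ∀ φ : Brandt.ClassSet S.O → ℤ, φ ≠ 0 →
          Brandt.eigenLattice (N / ℓ * ℓ) (Brandt.matrix S.O)
              (fun n => (freyCurve (-(ℓ : ℤ)) ((ℓ - 1 : ℕ) : ℤ)).LFunction n) = ℤ ∙ φ →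
          ∃ ψ : Brandt.ClassSet S.O → ℤ,
            ∑ i, (Brandt.weight S.O i : ℤ) * ψ i * φ i = 0 ∧
              ∀ i, ((2 ^ ((q - 1).factorization 2 - c) : ℕ) : ℤ) ∣ φ i - ψ i :=
  fun h => forcedPairOccurrence_of_dvd_xi h

/-! ## Non-vacuity of the side conditions -/

/-- **The forced family is non-empty with a non-trivial modulus**: `(q, ℓ) = (17, 5441)` are
primes with `q ≠ 2`, `32·17 = 544 ∣ 5440` and `v₂(q − 1) = v₂ 16 = 4`, so for `c ≤ 3` the stub
asks for an occurrence modulo `2^{4−c} ≥ 2` (the smallest in-scope pair is `(3, 97)`, where the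
modulus is `2^{1−c}`). -/
theorem forcedPair_sideConditions_nonvacuous :
    ∃ q ℓ : ℕ, q.Prime ∧ ℓ.Prime ∧ q ≠ 2 ∧ 32 * q ∣ ℓ - 1 ∧ (q - 1).factorization 2 = 4 := by
  refine ⟨17, 5441, by norm_num, by norm_num, by decide, by norm_num, ?_⟩
  have h : (17 - 1 : ℕ) = 2 ^ 4 := by norm_num
  rw [h, Nat.prime_two.factorization_pow, Finsupp.single_eq_same]

end Summit.ABC.ABC.Theorems

end
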